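import Mathlib
import HarnessLib
import Summits.HubbardSuperconductivity.HubbardSuperconductivity.Theorems.KLProgrammeKLRegimeVolumeLimitV11HinstDoors
import Summits.HubbardSuperconductivity.HubbardSuperconductivity.Theorems.KLProgrammeKLRegimeVolumeLimitV11GridProfileDoors
import Summits.HubbardSuperconductivity.HubbardSuperconductivity.Theorems.KLProgrammeKLRegimeTwoVolumeTowerBaseTransferData

/-!
# Route `KLProgramme` — crux K3, VL child `KLRegimeVolumeLimitV17F2` (stmt-HubbardSuperconductivity-20440), skeleton «cauchy» v11: THE `hSup` DISCHARGER,
# part 6 — THE ATOM `Hbase` FROM THE SCALE-0 LANE'S TWO PRIMITIVE ATOMS (i)(ii) (seat hubbard-kl-k3c4-p1 g16; `--supports` 20440)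

`…V11HSupOfAtoms.hSupRegBody_of_atoms`' atom `Hbase` is the UNSCALED base-transfer bundle (the seven conjuncts of `hdataT`) with its scalars.  By
`…TowerBaseTransferData.towerBase_transferData_of_atoms` (k3c4-p1 g14) those seven conjuncts follow from: (i) the `(1 + ΛgT·tnorm)`-weighted rows/columns `≤ cgW` of the
alive block `ε • E(F_0[K_L])·S_N` and of the source block `klSrcPlainBlock·S_N` on the fine lattice; (ii) the rows/columns `≤ δg L → 0` of the frame difference
`ε • (E(F_0[K_{bL}]) − E(F_0[K_L]))·S_N`; (iii′) the two grid actions' weighted profiles — and (iii′) is now a theorem under regime doors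
(`…V11GridProfileDoors.exists_klGridAction_wtProfile_doors`, rate `Λg = 1`, from k3c4-p2's landed rows and the frame kernel's moment).  Hence the atom shrinks to
**`HB0`** = (i) ∧ (ii) in the «post-tower instance» shape (constants `ΛgT > 0`, `cgW ≥ 0`, cap `δgb`, rate `δg → 0`).

* **`hbase_of_baseAtoms`** — `HB0 → Hbase` (for every `(G, P, Q, R)` with `R.WF2`; the admissible frames `K_L`, `K_{bL}` come from the tower via
  `histP_top_of_towerP` + `frameOK_klFlowFrameU_of_histP_le`).

Proofs only; no definition.  Honest framing: plumbing; nothing here asserts `HB0`, any stub, K3, VL or superconductivity.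
[cite: BenfattoGiulianiMastropietro2006, §2.7 (2.70)–(2.71a), §3 (3.3)]
-/

noncomputable section

namespace Summit.HubbardSuperconductivity.HubbardSuperconductivity.Theorems.TwoVolumeSource

set_option linter.dupNamespace false -- summit = problem name (single-conjunct summit), D-0017

open Finset Filter Topology Literature.MathematicalPhysics.QuantumLattice GrassmannAlgebra Literature.Probability.LatticeModels
  Literature.Probability.LatticeModels.BattleFederbush
open Summit.HubbardSuperconductivity.HubbardSuperconductivity.Theorems.KLRegimeSplit
open Summit.HubbardSuperconductivity.HubbardSuperconductivity.Theorems.KLProgrammeLegKernels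
open Summit.HubbardSuperconductivity.HubbardSuperconductivity.Theorems.TwoPointAssembly
open Summit.HubbardSuperconductivity.HubbardSuperconductivity.Theorems.EngineV8
open Summit.HubbardSuperconductivity.HubbardSuperconductivity.Theorems.TwoVolumeDefect
open Summit.HubbardSuperconductivity.HubbardSuperconductivity.Theorems.TorusFourierL2

set_option maxHeartbeats 3200000 in -- long binders
/-- **`HB0 → Hbase`** (see the module docstring). [folklore: composition; cite: BenfattoGiulianiMastropietro2006, §2.7 (2.70)–(2.71a), §3 (3.3)] -/
theorem hbase_of_baseAtoms
    (HB0 : ∀ (G : GeoConsts) (P : SplitConsts) (Q : EngConsts) (R : RenConsts), G.WF → P.WF → Q.WF → R.WF2 →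
        ∃ c₇ : ℝ, 0 < c₇ ∧ ∀ c : ℝ, 0 < c → c ≤ c₇ → ∃ U₇ : ℝ, 0 < U₇ ∧
          ∀ μ ∈ klWindowC, ∀ U : ℝ, 0 < U → U ≤ U₇ → ∀ β : ℝ, klBetaMin ≤ β → β ≤ Real.exp (c / U ^ 2) →
            ∀ (K : TrigPolyC4v) (Lstar : ℕ) (Mstar : ℕ → ℕ), TowerP klPredsV17F2 G P Q R β U μ K Lstar Mstar →
            ∃ (ΛgT cgW δgb : ℝ) (δg : ℕ → ℝ), 0 < ΛgT ∧ 0 ≤ cgW ∧ (∀ L, 0 ≤ δg L ∧ δg L ≤ δgb) ∧ Tendsto δg atTop (𝓝 0) ∧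
            ∃ L₂ : ℕ, ∃ M₂ : ℕ → ℕ → ℕ, ∀ (L b M : ℕ) [NeZero L] [NeZero (b * L)] [NeZero M], L₂ ≤ L → M₂ L b ≤ M →
              (∀ Y : SpaceTimeIdx (b * L) M × SectorLeg (sectorCount 0), ∑ y : GridLeg (GridPoint (b * L) (klGridN M)),
      ‖((((imagTimeWeight β M : ℝ) : ℂ) • sectorAnalysisMatrix (b * L) M β (klAnisoFamily (b * L) M β μ (klFlowFrameU L M β U μ (nScales β + 1)) klE0 0)) * hubbardGridSub (b * L) M β (klGridN M)) Y y‖ *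
        (1 + ΛgT * (Torus.tnorm (Y.1.2 - y.1.1.2) : ℝ)) ≤ cgW) ∧
              (∀ y : GridLeg (GridPoint (b * L) (klGridN M)), ∑ Y : SpaceTimeIdx (b * L) M × SectorLeg (sectorCount 0),
      ‖((((imagTimeWeight β M : ℝ) : ℂ) • sectorAnalysisMatrix (b * L) M β (klAnisoFamily (b * L) M β μ (klFlowFrameU L M β U μ (nScales β + 1)) klE0 0)) * hubbardGridSub (b * L) M β (klGridN M)) Y y‖ *
        (1 + ΛgT * (Torus.tnorm (Y.1.2 - y.1.1.2) : ℝ)) ≤ cgW) ∧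
              (∀ Y : SpaceTimeIdx (b * L) M × SectorLeg (sectorCount 0), ∑ y : GridLeg (GridPoint (b * L) (klGridN M)),
      ‖(klSrcPlainBlock (b * L) M β * hubbardGridSub (b * L) M β (klGridN M)) Y y‖ * (1 + ΛgT * (Torus.tnorm (Y.1.2 - y.1.1.2) : ℝ)) ≤ cgW) ∧
              (∀ y : GridLeg (GridPoint (b * L) (klGridN M)), ∑ Y : SpaceTimeIdx (b * L) M × SectorLeg (sectorCount 0),
      ‖(klSrcPlainBlock (b * L) M β * hubbardGridSub (b * L) M β (klGridN M)) Y y‖ * (1 + ΛgT * (Torus.tnorm (Y.1.2 - y.1.1.2) : ℝ)) ≤ cgW) ∧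
              (∀ Y : SpaceTimeIdx (b * L) M × SectorLeg (sectorCount 0), ∑ y : GridLeg (GridPoint (b * L) (klGridN M)),
      ‖((((imagTimeWeight β M : ℝ) : ℂ) • (sectorAnalysisMatrix (b * L) M β (klAnisoFamily (b * L) M β μ (klFlowFrameU (b * L) M β U μ (nScales β + 1)) klE0 0) -
          sectorAnalysisMatrix (b * L) M β (klAnisoFamily (b * L) M β μ (klFlowFrameU L M β U μ (nScales β + 1)) klE0 0))) * hubbardGridSub (b * L) M β (klGridN M)) Y y‖ ≤ δg L) ∧
              (∀ y : GridLeg (GridPoint (b * L) (klGridN M)), ∑ Y : SpaceTimeIdx (b * L) M × SectorLeg (sectorCount 0),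
      ‖((((imagTimeWeight β M : ℝ) : ℂ) • (sectorAnalysisMatrix (b * L) M β (klAnisoFamily (b * L) M β μ (klFlowFrameU (b * L) M β U μ (nScales β + 1)) klE0 0) -
          sectorAnalysisMatrix (b * L) M β (klAnisoFamily (b * L) M β μ (klFlowFrameU L M β U μ (nScales β + 1)) klE0 0))) * hubbardGridSub (b * L) M β (klGridN M)) Y y‖ ≤ δg L))
    (G : GeoConsts) (P : SplitConsts) (Q : EngConsts) (R : RenConsts) (hG : G.WF) (hP : P.WF) (hQ : Q.WF) (hR2 : R.WF2) :
        ∃ c₇ : ℝ, 0 < c₇ ∧ ∀ c : ℝ, 0 < c → c ≤ c₇ → ∃ U₇ : ℝ, 0 < U₇ ∧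
          ∀ μ ∈ klWindowC, ∀ U : ℝ, 0 < U → U ≤ U₇ → ∀ β : ℝ, klBetaMin ≤ β → β ≤ Real.exp (c / U ^ 2) →
            ∀ (K : TrigPolyC4v) (Lstar : ℕ) (Mstar : ℕ → ℕ), TowerP klPredsV17F2 G P Q R β U μ K Lstar Mstar →
            ∃ (ΛgT cgW Λg δgb : ℝ) (NG : ℕ → ℝ) (δg : ℕ → ℝ), 0 < ΛgT ∧ 0 ≤ cgW ∧ 0 < Λg ∧ (∀ k, 0 ≤ NG k) ∧ (∀ L, 0 ≤ δg L ∧ δg L ≤ δgb) ∧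
              Tendsto δg atTop (𝓝 0) ∧
            ∃ L₂ : ℕ, ∃ M₂ : ℕ → ℕ → ℕ, ∀ (L b M : ℕ) [NeZero L] [NeZero (b * L)] [NeZero M], L₂ ≤ L → M₂ L b ≤ M →
              (∀ x : SrcLabel (b * L) M 0, ∑ y, ‖klBaseTransfer (b * L) M β μ (klFlowFrameU L M β U μ (nScales β + 1)) x y‖ * (1 + ΛgT * (Torus.tnorm (x.1.1.2 - y.1.1.1.2) : ℝ)) ≤ cgW) ∧
              (∀ y : GridLeg (GridPoint (b * L) (klGridN M)) × Fin 2, ∑ x, ‖klBaseTransfer (b * L) M β μ (klFlowFrameU L M β U μ (nScales β + 1)) x y‖ * (1 + ΛgT * (Torus.tnorm (x.1.1.2 - y.1.1.1.2) : ℝ)) ≤ cgW) ∧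
              (∀ (δ' β' β₁ : Fin 2 → Fin b) (xbar : SrcLabel L M 0) (y : GridLeg (GridPoint L (klGridN M)) × Fin 2),
                ‖klBaseTransfer (b * L) M β μ (klFlowFrameU L M β U μ (nScales β + 1)) ((klBlockEquivD L b M 0).symm (β' + δ', xbar)) ((klGridBlockEquivD L b M).symm (β₁ + δ', y))‖ =
                  ‖klBaseTransfer (b * L) M β μ (klFlowFrameU L M β U μ (nScales β + 1)) ((klBlockEquivD L b M 0).symm (β', xbar)) ((klGridBlockEquivD L b M).symm (β₁, y))‖) ∧
              (∀ x, ∑ y, ‖klBaseTransfer (b * L) M β μ (klFlowFrameU (b * L) M β U μ (nScales β + 1)) x y - klBaseTransfer (b * L) M β μ (klFlowFrameU L M β U μ (nScales β + 1)) x y‖ ≤ δg L) ∧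
              (∀ y, ∑ x, ‖klBaseTransfer (b * L) M β μ (klFlowFrameU (b * L) M β U μ (nScales β + 1)) x y - klBaseTransfer (b * L) M β μ (klFlowFrameU L M β U μ (nScales β + 1)) x y‖ ≤ δg L) ∧
              (∀ (k : ℕ) (p : Fin k) (y : GridLeg (GridPoint L (klGridN M))),
                ∑ Y ∈ univ.filter (fun Y : Fin k → GridLeg (GridPoint L (klGridN M)) => Y p = y),
                  ‖kernel ℂ (klGridAction L M β U μ (klFlowFrameU L M β U μ (nScales β + 1))) k Y‖ *
                    (1 + labelDiam (fun Y₁ Y₂ : GridLeg (GridPoint L (klGridN M)) => Λg * (Torus.tnorm (Y₁.1.1.2 - Y₂.1.1.2) : ℝ)) (univ.image Y)) ≤ imagTimeWeight β M * NG k) ∧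
              (∀ (k : ℕ) (p : Fin k) (y : GridLeg (GridPoint (b * L) (klGridN M))),
                ∑ Y ∈ univ.filter (fun Y : Fin k → GridLeg (GridPoint (b * L) (klGridN M)) => Y p = y),
                  ‖kernel ℂ (klGridAction (b * L) M β U μ (klFlowFrameU (b * L) M β U μ (nScales β + 1))) k Y‖ *
                    (1 + labelDiam (fun Y₁ Y₂ : GridLeg (GridPoint (b * L) (klGridN M)) => Λg * (Torus.tnorm (Y₁.1.1.2 - Y₂.1.1.2) : ℝ)) (univ.image Y)) ≤ imagTimeWeight β M * NG k) := by
  obtain ⟨c₀, hc₀, hb0⟩ := HB0 G P Q R hG hP hQ hR2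
  obtain ⟨c₉, U₉, hc₉, hU₉, NG, hNG0, hgrid⟩ := exists_klGridAction_wtProfile_doors R hR2.wf
  refine ⟨min c₀ c₉, lt_min hc₀ hc₉, fun c hc hcc => ?_⟩
  obtain ⟨U₀, hU₀, hb0c⟩ := hb0 c hc (hcc.trans (min_le_left _ _))
  refine ⟨min U₀ U₉, lt_min hU₀ hU₉, fun μ hμ U hU hUU β hβmin hβc K Lstar Mstar hT => ?_⟩
  obtain ⟨ΛgT, cgW, δgb, δg, hΛgT, hcgW, hδg, hδg0, L₂, M₂, hI⟩ := hb0c μ hμ U hU (hUU.trans (min_le_left _ _)) β hβmin hβc K Lstar Mstar hT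
  have hβ : 0 < β := KLRegimeSplit.pos_of_klBetaMin_le hβmin
  refine ⟨ΛgT, cgW, 1, δgb, NG, δg, hΛgT, hcgW, one_pos, hNG0, hδg, hδg0, max L₂ (max Lstar (klEngL₃ β U)),
    fun L b => max (M₂ L b) (max (max (Mstar L) (Mstar (b * L))) (max (klEngM₃ β U L) (klEngM₃ β U (b * L)))), fun L b M _ _ _ hL hM => ?_⟩
  dsimp only at hM
  have hL₂ : L₂ ≤ L := by omega
  have hLs : Lstar ≤ L := by omega
  have hL3 : klEngL₃ β U ≤ L := by omega
  have hM₂ : M₂ L b ≤ M := by omega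
  have hMs : Mstar L ≤ M := by omega
  have hMsb : Mstar (b * L) ≤ M := by omega
  have hM3 : klEngM₃ β U L ≤ M := by omega
  have hM3b : klEngM₃ β U (b * L) ≤ M := by omega
  have hb1 : 1 ≤ b := Nat.pos_of_ne_zero fun hb => NeZero.ne (b * L) (by rw [hb, Nat.zero_mul])
  have hLbL : L ≤ b * L := Nat.le_mul_of_pos_left L hb1
  have hn1 : 1 ≤ nScales β + 1 := Nat.le_add_left 1 _
  -- the admissible flow frames of the two volumes
  have hK : FrameOK R U (nScales β) μ (klFlowFrameU L M β U μ (nScales β + 1)) :=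
    frameOK_klFlowFrameU_of_histP_le hR2 hn1 le_rfl le_rfl (histP_top_of_towerP hT hLs hMs)
  have hKb : FrameOK R U (nScales β) μ (klFlowFrameU (b * L) M β U μ (nScales β + 1)) :=
    frameOK_klFlowFrameU_of_histP_le hR2 hn1 le_rfl le_rfl (histP_top_of_towerP hT (hLs.trans hLbL) hMsb)
  obtain ⟨hArow, hAcol, hBrow, hBcol, hDrow, hDcol⟩ := hI L b M hL₂ hM₂
  have hGc := hgrid (V := L) (M := M) hK hβmin hc.le (hcc.trans (min_le_right _ _)) hβc hU (hUU.trans (min_le_right _ _)) hL3 hM3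
  have hGf := hgrid (V := b * L) (M := M) hKb hβmin hc.le (hcc.trans (min_le_right _ _)) hβc hU (hUU.trans (min_le_right _ _)) (hL3.trans hLbL) hM3b
  exact towerBase_transferData_of_atoms hβ.ne' U μ (klFlowFrameU L M β U μ (nScales β + 1)) (klFlowFrameU (b * L) M β U μ (nScales β + 1)) (hδg L).1 NG
    hArow hAcol hBrow hBcol hDrow hDcol hGc hGf

end Summit.HubbardSuperconductivity.HubbardSuperconductivity.Theorems.TwoVolumeSource

end
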